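import Literature.NumberTheory.EllipticCurves.BSDSelmerPConverseRamifiedProofs
import HarnessLib

/-!
# Burungale–Skinner–Tian–Wan, Thm. 1.10 (`p`-converse in corank one): decomposition into its printed leaves

Family `bsd` (bsd.S25), topic `Literature/NumberTheory/EllipticCurves`.  The named fact
`Literature.NumberTheory.EllipticCurves.burungaleSkinnerTianWan_analyticRank_eq_one_of_selmerCorank_eq_one`
(`BSDSelmer.lean`; A. Burungale, C. Skinner, Y. Tian, X. Wan, *Zeta elements for elliptic curves
and applications*, arXiv:2409.01350, Thm. 1.10: for `E/ℚ`, `p ∤ 2N` ordinary, (sur_ℚ) and (ram),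
`corank_{ℤ_p} Sel_{p^∞}(E/ℚ) = 1 ⟹ ord_{s=1} L(E, s) = 1`) is proved in the tree from the five
printed ingredients of its proof (proof of Thm. 12.3, p. 96, and Thm. 12.11, p. 98 — Part II, §12 of
arXiv:2409.01350v2; "Thm. 4.3, p. 82 / Thm. 4.11, p. 84" of the held TeX-derived text, see the
locator erratum under References) by `burungaleSkinnerTianWan_analyticRank_eq_one_of_selmerCorank_eq_one_of_leaves`
(`BSDSelmerPConverseRamifiedProofs.lean`; step (d), the Selmer corank of a quadratic base change,
and the lifting (sur_ℚ) + (ram) ⟹ (sur) being theorems of the tree).  This file records that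
decomposition as the assembly `…_holds_of` over the five EXISTING named facts, each a distinct
published theorem:

* (a) the `p`-parity theorem `p_parity W p` for every elliptic `W/ℚ` and prime `p`
  (T. Dokchitser, V. Dokchitser, Ann. of Math. 172 (2010), Thm. 1.4; `BSDSelmer.lean`);
* (b) the Friedberg–Hoffstein auxiliary imaginary quadratic field
  `friedbergHoffstein_exists_heegnerField_split_twist_ne_zero` (Ann. of Math. 142 (1995), main
  theorem, special case; `BSDSelmerPConverse.lean`);
* (c) Kato's finiteness theorem `kato_finite_of_L_one_ne_zero W p` (Astérisque 295 (2004),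
  Cor. 14.3; `PAdicBSD.lean`);
* (e) the `p`-converse over the auxiliary field
  `burungaleSkinnerTianWan_analyticRankEK_eq_one_of_selmerCorank_eq_one` (BSTW
  Prop. 12.10 with Thm. 12.9: Kato's main conjecture and the Heegner main conjecture;
  `BSDSelmerPConverse.lean`) — the deep leaf;
* (f) modularity / entire continuation `WeierstrassCurve.hasEntireLFunction_rat`
  (Breuil–Conrad–Diamond–Taylor 2001, Thm. A; `AnalyticRank.lean`).

No new named fact is introduced and nothing is discharged; none of the five is the parent
reworded (the parent is a statement over `ℚ` under (ram); (e) is over an imaginary quadratic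
field under the Heegner hypothesis, the others are theorems of a different shape altogether).

## References

* [BurungaleSkinnerTianWan2024] arXiv:2409.01350v2, PRINTED numbering and arXiv v2 PDF pages:
  Thm. 1.10 (p. 5); §12: proof of Thm. 12.3 (p. 96), Thm. 12.9, Prop. 12.10, Thm. 12.11 (p. 98).
  LOCATOR ERRATUM (2026-08-25, checked against the arXiv v2 PDF): earlier revisions of this file
  gave these as "Part II §4, proof of Thm. 4.3 (p. 82), Prop. 4.10, Thm. 4.9, Thm. 4.11 (p. 84)" —
  the numbering of the held TeX-derived text (`lit read arxiv:2409.01350`), whose "p. N" are chunk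
  indices and whose extraction restarts the section counter inside Part II (held §s = printed
  §(s+8)); the paper numbers §1–§12 continuously; the quoted words are unchanged.
* [DokchitserDokchitserAnnals2010] Thm. 1.4. [Kato2004Asterisque] Cor. 14.3.
  [FriedbergHoffstein1995] main theorem. [BCDTJAMS2001] Thm. A.
-/

noncomputable section

open scoped Classical

open WeierstrassCurve

namespace Literature.NumberTheory.EllipticCurves

/-- **Assembly: Burungale–Skinner–Tian–Wan, Thm. 1.10, from the five printed leaves of its proof**
— (a) `p`-parity (Dokchitser–Dokchitser 2010, Thm. 1.4), (b) the Friedberg–Hoffstein field,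
(c) Kato's finiteness theorem, (e) the `p`-converse over the auxiliary imaginary quadratic field
(BSTW Prop. 12.10), (f) modularity — by
`burungaleSkinnerTianWan_analyticRank_eq_one_of_selmerCorank_eq_one_of_leaves`
(`BSDSelmerPConverseRamifiedProofs.lean`). [cite: BurungaleSkinnerTianWan2024, Thm. 1.10 (p. 5) and proof of Thm. 12.3 (p. 96) with Thm. 12.11 (p. 98)] -/
theorem burungaleSkinnerTianWan_analyticRank_eq_one_of_selmerCorank_eq_one_holds_of :
    (∀ (W : WeierstrassCurve ℚ) [W.IsElliptic] (p : ℕ) [Fact p.Prime], p_parity W p) →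
    friedbergHoffstein_exists_heegnerField_split_twist_ne_zero →
    (∀ (W : WeierstrassCurve ℚ) [W.IsElliptic] (p : ℕ) [Fact p.Prime],
      kato_finite_of_L_one_ne_zero W p) →
    burungaleSkinnerTianWan_analyticRankEK_eq_one_of_selmerCorank_eq_one →
    WeierstrassCurve.hasEntireLFunction_rat →
      burungaleSkinnerTianWan_analyticRank_eq_one_of_selmerCorank_eq_one :=
  fun hpar hFH hKato hL hE =>
    burungaleSkinnerTianWan_analyticRank_eq_one_of_selmerCorank_eq_one_of_leaves hpar hFH hKato hL hE

/-- The interim bsd.S25 statement `analyticRank_eq_one_of_selmerCorank_eq_one` (a weakening of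
Thm. 1.10, `BSDSelmer.lean`) from the same five leaves. [cite: BurungaleSkinnerTianWan2024, Thm. 1.10] -/
theorem analyticRank_eq_one_of_selmerCorank_eq_one_holds_of :
    (∀ (W : WeierstrassCurve ℚ) [W.IsElliptic] (p : ℕ) [Fact p.Prime], p_parity W p) →
    friedbergHoffstein_exists_heegnerField_split_twist_ne_zero →
    (∀ (W : WeierstrassCurve ℚ) [W.IsElliptic] (p : ℕ) [Fact p.Prime],
      kato_finite_of_L_one_ne_zero W p) →
    burungaleSkinnerTianWan_analyticRankEK_eq_one_of_selmerCorank_eq_one →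
    WeierstrassCurve.hasEntireLFunction_rat →
      analyticRank_eq_one_of_selmerCorank_eq_one :=
  fun hpar hFH hKato hL hE =>
    analyticRank_eq_one_of_selmerCorank_eq_one_of_leaves hpar hFH hKato hL hE

end Literature.NumberTheory.EllipticCurves
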